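import Mathlib
import Summits.CriticalPhenomena.CardyFormulaZ2.Theorems.CardySelfRefinementDefs
import Summits.CriticalPhenomena.CardyFormulaZ2.Theorems.CardySelfRefinementTrivialSectorRateStubBoundaryRelevanceBoundaryCount
import HarnessLib

/-!
# Two-scale boundary block count for polygonal quad families (stub `stub_boundaryRelevance`,
line `far-field-is-a-quarter-turn`, crux `TrivialSectorRate`, stmt-CriticalPhenomena-10266)

The hypothesis `hcount` of the two-scale reduction `boundaryRelevance_small_of_twoScale`
(`…StubBoundaryRelevanceTwoScale.lean`) asks, at the scales `D ≥ 1`, `Dη < 1`, for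
`#{u ∈ U : bdist u < 2Dη, infDist(η·z(k•u), P) < ℓ} ≤ L · D · η⁻¹ · min(ℓ, 1)` for every level
`ℓ ≥ 2Dη`: the blocks within plane distance `2Dη` of the quad boundaries AND within `ℓ` of the
finite exceptional set `P` are `O(ℓ D / η)` (and `O(D/η)` in all).  This file proves it for every
POLYGONAL family (`frontier [F i]` a finite union of segments, `m ≥ 1`, `k ≥ 1`) and every finite
NONEMPTY `P ⊂ ℂ` — no relation between `P` and the segments is needed (deterministic geometry, no
probability):

* `exists_subsegment_of_inter_closedBall` — the part of a segment `[a, b]` inside a closed disc of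
  radius `r` lies in a sub-segment of length `≤ 2r` (the parameters of the points of `[a,b]` in
  the disc form a compact set; take its infimum and supremum);
* `twoScaleCount_of_polygonal` (registered helper) — the count: a block centre within `t = 2Dη` of
  the boundary and within `ℓ` of `P` is within `t` of the part of one of the segments inside the
  disc of radius `ℓ + t ≤ 2ℓ` about one of the points of `P`, a sub-segment of length `≤ 4ℓ`, and
  `card_filter_infDist_segment_lt_le` counts `≤ (4ℓ/t + 2)(9D)² ≤ 243 ℓ D/η` centres of the
  lattice `η√2k ℤ²` there; for `ℓ ≥ 1` the plain count `card_filter_bdist_lt_le_of_polygonal`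
  (`≤ 2 L_F D η⁻¹`) is used instead.  `L = max (2 L_F) (243 · #segments · #P)`.
-/

noncomputable section

namespace Summit.CriticalPhenomena.CardyFormulaZ2.Theorems.CardySelfRefinement.FarField

open scoped Topology
open Filter Set MeasureTheory
open Literature.Probability.LatticeModels Literature.Probability.Percolation
open Literature.Probability.Percolation.QuadCrossing
open Summit.CriticalPhenomena.CardyFormulaZ2.Theses.CardySelfRefinement

/-! ## The part of a segment inside a disc -/

/-- **The part of a segment inside a closed disc is a short sub-segment**: for `a b p : ℂ` and
`r ≥ 0` there are `a', b'` with `[a, b] ∩ B̄(p, r) ⊆ [a', b']` and `‖b' − a'‖ ≤ 2r`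
(`a' = a + θ₁(b−a)`, `b' = a + θ₂(b−a)` for the least and the largest parameter `θ ∈ [0,1]` whose
point lies in the disc; both lie in the disc, whence the length bound; if none does,
`a' = b' = a`). -/
theorem exists_subsegment_of_inter_closedBall (a b p : ℂ) {r : ℝ} (hr : 0 ≤ r) :
    ∃ a' b' : ℂ, segment ℝ a b ∩ Metric.closedBall p r ⊆ segment ℝ a' b' ∧ ‖b' - a'‖ ≤ 2 * r := by
  obtain ⟨g, hg⟩ : ∃ f : ℝ → ℂ, f = fun θ => a + θ • (b - a) := ⟨_, rfl⟩
  have hgc : Continuous g := by rw [hg]; fun_prop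
  have hseg : segment ℝ a b = g '' Set.Icc 0 1 := by rw [hg]; exact segment_eq_image' ℝ a b
  obtain ⟨I, hI⟩ : ∃ J : Set ℝ, J = Set.Icc 0 1 ∩ g ⁻¹' Metric.closedBall p r := ⟨_, rfl⟩
  have hmemI : ∀ θ, θ ∈ I ↔ θ ∈ Set.Icc (0 : ℝ) 1 ∧ g θ ∈ Metric.closedBall p r := fun θ => by
    rw [hI]; rfl
  have hIc : IsCompact I := hI ▸ isCompact_Icc.inter_right (Metric.isClosed_closedBall.preimage hgc)
  by_cases hne : I.Nonempty
  · have hθ₁ := (hmemI _).1 (hIc.sInf_mem hne)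
    have hθ₂ := (hmemI _).1 (hIc.sSup_mem hne)
    refine ⟨g (sInf I), g (sSup I), ?_, ?_⟩
    · rintro y ⟨hy, hyp⟩
      rw [hseg] at hy
      obtain ⟨θ, hθ, rfl⟩ := hy
      have hθI : θ ∈ I := (hmemI θ).2 ⟨hθ, hyp⟩
      have h1 : sInf I ≤ θ := csInf_le hIc.bddBelow hθI
      have h2 : θ ≤ sSup I := le_csSup hIc.bddAbove hθI
      rcases eq_or_lt_of_le (h1.trans h2) with heq | hlt
      · have hθeq : θ = sInf I := le_antisymm (heq ▸ h2) h1
        rw [hθeq]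
        exact left_mem_segment ℝ _ _
      · rw [segment_eq_image']
        have hne' : sSup I - sInf I ≠ 0 := (sub_pos.2 hlt).ne'
        refine ⟨(θ - sInf I) / (sSup I - sInf I),
          ⟨div_nonneg (by linarith) (by linarith), div_le_one_of_le₀ (by linarith) (by linarith)⟩,
          ?_⟩
        have hdiff : g (sSup I) - g (sInf I) = (sSup I - sInf I) • (b - a) := by
          rw [hg]
          simp only [Complex.real_smul]
          push_cast
          ring
        simp only
        rw [hdiff, smul_smul, div_mul_cancel₀ _ hne', hg]
        simp only [Complex.real_smul]
        push_cast
        ring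
    · have h1 : dist (g (sSup I)) p ≤ r := Metric.mem_closedBall.1 hθ₂.2
      have h2 : dist (g (sInf I)) p ≤ r := Metric.mem_closedBall.1 hθ₁.2
      calc ‖g (sSup I) - g (sInf I)‖ = dist (g (sSup I)) (g (sInf I)) := (dist_eq_norm _ _).symm
        _ ≤ dist (g (sSup I)) p + dist (g (sInf I)) p := dist_triangle_right _ _ _
        _ ≤ 2 * r := by linarith
  · refine ⟨a, a, ?_, by simp; positivity⟩
    rintro y ⟨hy, hyp⟩
    exfalso
    rw [hseg] at hy
    obtain ⟨θ, hθ, rfl⟩ := hy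
    exact hne ⟨θ, (hmemI θ).2 ⟨hθ, hyp⟩⟩

/-! ## The two-scale count -/

/-- **TWO-SCALE BOUNDARY BLOCK COUNT FOR POLYGONAL FAMILIES** (registered helper of
`stub_boundaryRelevance`; the hypothesis `hcount` of `boundaryRelevance_small_of_twoScale`).  For
`k ≥ 1`, `m ≥ 1`, a family of quads with polygonal boundaries and a finite nonempty `P ⊂ ℂ` there
is `L` such that for `0 < η < 1`, `D ≥ 1`, `Dη < 1`, every level `ℓ ≥ 2Dη` and every finite
`U ⊆ ℤ²`: `#{u ∈ U : bdist u < 2Dη, infDist(η·z(k•u), P) < ℓ} ≤ L · D · η⁻¹ · min(ℓ, 1)`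
(`L = max (2 L_F) (243 · #segments · #P)`, see the module docstring). -/
theorem twoScaleCount_of_polygonal {k : ℕ} (hk : 0 < k) {m : ℕ} (hm : 0 < m)
    (F : Fin m → Quad (univ : Set ℂ))
    (hF : ∀ i, ∃ S : Finset (ℂ × ℂ), frontier (Set.range (F i)) = ⋃ p ∈ S, segment ℝ p.1 p.2)
    (P : Finset ℂ) (hP : P.Nonempty) :
    ∃ L η₁ : ℝ, 0 < η₁ ∧ ∀ η ∈ Set.Ioo (0 : ℝ) η₁, ∀ (D : ℕ), 1 ≤ D → (D : ℝ) * η < 1 →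
      ∀ ℓ : ℝ, 2 * D * η ≤ ℓ → ∀ U : Finset (Site 2),
        ((U.filter (fun u => bdist k m F η u < 2 * D * η ∧
            Metric.infDist ((η : ℂ) * squareLatticeEmbedding.z (ctr k u)) (P : Set ℂ) < ℓ)).card :
          ℝ) ≤ L * D * η⁻¹ * min ℓ 1 := by
  classical
  obtain ⟨L₀, hL₀0, hL₀⟩ := card_filter_bdist_lt_le_of_polygonal hk hm F hF
  choose S hS using hF
  set T : Finset (ℂ × ℂ) := Finset.univ.biUnion S with hT
  -- every boundary point lies on a segment of `T`
  have hbd : ∀ y ∈ quadBdry m F, ∃ q ∈ T, y ∈ segment ℝ q.1 q.2 := by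
    intro y hy
    obtain ⟨i, hi⟩ := Set.mem_iUnion.1 hy
    rw [hS i] at hi
    obtain ⟨q, hq, hyq⟩ := Set.mem_iUnion₂.1 hi
    exact ⟨q, Finset.mem_biUnion.2 ⟨i, Finset.mem_univ _, hq⟩, hyq⟩
  have hne : (quadBdry m F).Nonempty := by
    obtain ⟨y, hy⟩ := frontier_range_nonempty (F ⟨0, hm⟩)
    exact ⟨y, Set.mem_iUnion.2 ⟨⟨0, hm⟩, hy⟩⟩
  refine ⟨max (2 * L₀) (243 * T.card * P.card), 1, one_pos, fun η hη D hD hDη ℓ hℓ U => ?_⟩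
  have hη : 0 < η := hη.1
  have hD1 : (1 : ℝ) ≤ D := by exact_mod_cast hD
  have hD0 : (0 : ℝ) < D := by linarith
  have hηinv : 0 < η⁻¹ := inv_pos.2 hη
  rcases lt_or_ge 1 ℓ with hℓ1 | hℓ1
  · -- large levels: the plain count
    rw [min_eq_right hℓ1.le, mul_one]
    have hDle : (D : ℝ) ≤ η⁻¹ := by
      rw [le_inv_comm₀ hD0 hη, inv_eq_one_div, le_div_iff₀ hD0]
      linarith
    calc ((U.filter (fun u => bdist k m F η u < 2 * D * η ∧
            Metric.infDist ((η : ℂ) * squareLatticeEmbedding.z (ctr k u)) (P : Set ℂ) < ℓ)).card :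
            ℝ)
        ≤ ((U.filter (fun u => bdist k m F η u < 2 * D * η)).card : ℝ) := by
          exact_mod_cast Finset.card_le_card (fun u hu => by
            rw [Finset.mem_filter] at hu ⊢
            exact ⟨hu.1, hu.2.1⟩)
      _ ≤ L₀ * D * ((D : ℝ) + η⁻¹) := hL₀ η hη D hD U
      _ ≤ L₀ * D * (η⁻¹ + η⁻¹) := by gcongr
      _ = 2 * L₀ * D * η⁻¹ := by ring
      _ ≤ max (2 * L₀) (243 * T.card * P.card) * D * η⁻¹ := by gcongr; exact le_max_left _ _
  · -- small levels: the two-scale count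
    rw [min_eq_left hℓ1]
    set s' : ℝ := η * Real.sqrt 2 * k with hs'
    set t : ℝ := 2 * D * η with ht
    have hk1 : (1 : ℝ) ≤ k := by exact_mod_cast hk
    have ht0 : 0 < t := by positivity
    have hℓ0 : 0 < ℓ := lt_of_lt_of_le ht0 hℓ
    have hsqrt : (1 : ℝ) ≤ Real.sqrt 2 := by
      rw [show (1 : ℝ) = Real.sqrt 1 by simp]
      exact Real.sqrt_le_sqrt (by norm_num)
    have hs'η : η ≤ s' := by
      have : η * 1 * 1 ≤ η * Real.sqrt 2 * k :=
        mul_le_mul (mul_le_mul_of_nonneg_left hsqrt hη.le) hk1 zero_le_one (by positivity)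
      simpa [hs'] using this
    have hs'0 : 0 < s' := lt_of_lt_of_le hη hs'η
    -- the sub-segments: the part of each segment inside the disc of radius `ℓ + t` about each point
    have hsubseg := fun qp : (ℂ × ℂ) × ℂ =>
      exists_subsegment_of_inter_closedBall qp.1.1 qp.1.2 qp.2 (r := ℓ + t) (by positivity)
    choose a' b' hab hlen using hsubseg
    -- the blocks are near one of the sub-segments
    have hsub : U.filter (fun u => bdist k m F η u < 2 * D * η ∧
          Metric.infDist ((η : ℂ) * squareLatticeEmbedding.z (ctr k u)) (P : Set ℂ) < ℓ) ⊆
        (T ×ˢ P).biUnion (fun qp => U.filter (fun u =>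
          Metric.infDist ((s' : ℂ) * Site.toComplex u) (segment ℝ (a' qp) (b' qp)) < t)) := by
      intro u hu
      obtain ⟨huU, h1, h2⟩ := Finset.mem_filter.1 hu
      have h1' : Metric.infDist ((s' : ℂ) * Site.toComplex u) (quadBdry m F) < t := by
        simpa [bdist, center_eq_spacing_mul, hs', ht] using h1
      have h2' : Metric.infDist ((s' : ℂ) * Site.toComplex u) (P : Set ℂ) < ℓ := by
        simpa [center_eq_spacing_mul, hs'] using h2
      obtain ⟨y, hy, hdy⟩ := (Metric.infDist_lt_iff hne).1 h1'
      obtain ⟨q, hq, hyq⟩ := hbd y hy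
      obtain ⟨p, hp, hdp⟩ :=
        (Metric.infDist_lt_iff (by exact_mod_cast hP : (P : Set ℂ).Nonempty)).1 h2'
      have hyp : y ∈ Metric.closedBall p (ℓ + t) := by
        rw [Metric.mem_closedBall]
        have := dist_triangle_left y p ((s' : ℂ) * Site.toComplex u)
        linarith
      refine Finset.mem_biUnion.2 ⟨(q, p), Finset.mem_product.2 ⟨hq, Finset.mem_coe.1 hp⟩,
        Finset.mem_filter.2 ⟨huU, ?_⟩⟩
      exact (Metric.infDist_le_dist_of_mem (hab (q, p) ⟨hyq, hyp⟩)).trans_lt hdy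
    -- numerics
    have hfac : 2 * (2 * t / s') + 1 ≤ 9 * D := by
      have h1 : 2 * t / s' ≤ 2 * t / η := div_le_div_of_nonneg_left (by positivity) hη hs'η
      have h2 : 2 * t / η = 4 * D := by rw [ht]; field_simp; ring
      linarith
    have hpair : ∀ qp ∈ T ×ˢ P,
        ((U.filter (fun u => Metric.infDist ((s' : ℂ) * Site.toComplex u)
          (segment ℝ (a' qp) (b' qp)) < t)).card : ℝ) ≤ 243 * ℓ * D * η⁻¹ := by
      intro qp _
      have hl : ‖b' qp - a' qp‖ / t + 2 ≤ 6 * ℓ / t := by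
        have h1 : ‖b' qp - a' qp‖ / t ≤ 2 * (ℓ + t) / t :=
          div_le_div_of_nonneg_right (hlen qp) ht0.le
        have h2 : 2 * (ℓ + t) / t = 2 * ℓ / t + 2 := by field_simp
        have h3 : (1 : ℝ) ≤ ℓ / t := by rw [le_div_iff₀ ht0]; linarith
        have h4 : 6 * ℓ / t = 2 * ℓ / t + 4 * (ℓ / t) := by ring
        linarith
      calc _ ≤ (‖b' qp - a' qp‖ / t + 2) * (2 * (2 * t / s') + 1) ^ 2 :=
            card_filter_infDist_segment_lt_le hs'0 ht0 (a' qp) (b' qp) U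
        _ ≤ (6 * ℓ / t) * (9 * D) ^ 2 := by gcongr
        _ = 243 * ℓ * D * η⁻¹ := by rw [ht]; field_simp; ring
    calc ((U.filter (fun u => bdist k m F η u < 2 * D * η ∧
            Metric.infDist ((η : ℂ) * squareLatticeEmbedding.z (ctr k u)) (P : Set ℂ) < ℓ)).card :
            ℝ)
        ≤ (((T ×ˢ P).biUnion (fun qp => U.filter (fun u =>
            Metric.infDist ((s' : ℂ) * Site.toComplex u) (segment ℝ (a' qp) (b' qp)) < t))).card :
            ℝ) := by
          exact_mod_cast Finset.card_le_card hsub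
      _ ≤ ∑ qp ∈ T ×ˢ P, ((U.filter (fun u =>
            Metric.infDist ((s' : ℂ) * Site.toComplex u) (segment ℝ (a' qp) (b' qp)) < t)).card :
            ℝ) := by
          exact_mod_cast Finset.card_biUnion_le
      _ ≤ ∑ _qp ∈ T ×ˢ P, 243 * ℓ * D * η⁻¹ := Finset.sum_le_sum hpair
      _ = 243 * T.card * P.card * D * η⁻¹ * ℓ := by
          rw [Finset.sum_const, Finset.card_product, nsmul_eq_mul]
          push_cast
          ring
      _ ≤ max (2 * L₀) (243 * T.card * P.card) * D * η⁻¹ * ℓ := by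
          gcongr
          exact le_max_right _ _

end Summit.CriticalPhenomena.CardyFormulaZ2.Theorems.CardySelfRefinement.FarField

end
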